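import Mathlib
import HarnessLib
import Literature.MathematicalPhysics.KineticTheory.HardSphereEulerProofs
import Literature.MathematicalPhysics.KineticTheory.HardSphereEulerLLN
import Summits.AtomisticToContinuum.HydrodynamicLimit.Theses.OneFlightGossipEngine
import Summits.AtomisticToContinuum.HydrodynamicLimit.Theorems.OneFlightGossipEngineUniformLocalGibbsConcentrationPerturb
import Summits.AtomisticToContinuum.HydrodynamicLimit.Theorems.OneFlightGossipEngineUniformLocalGibbsConcentrationDensity
import Summits.AtomisticToContinuum.HydrodynamicLimit.Theorems.ImplosionDichotomyHsEosLowDensity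
import Summits.AtomisticToContinuum.HydrodynamicLimit.Theorems.OneFlightGossipEngineClampedCurrentsDockFreezeToolkit

/-! # EOS fields along a profile family are jointly continuous — stub `stub_eosFieldFamilyModulus`
of line `Sketch`, crux `LocalClampedTransferLDAlongFamilies` (stmt-AtomisticToContinuum-17691)

For a jointly continuous positive activity family `a : ℝ → 𝕋³ → ℝ` on the slab `[0,t₁] × 𝕋³` and
`0 < σ < 1/2` under the packing guard `σ³ · sup a_s ≤ η₁ ∫ a_s` (`s ∈ [0,t₁]`), the x-frozen limit
density `ρ₀,s(x) = rhoLim (profileOf a_s) σ x = Σ_j γ_j R_s^{j+1} β_s(x)^{j+1}` (`β_s = a_s/∫a_s`,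
`R_s = ratioLimit`) and the EOS coefficients `Z(ρ₀,s σ³)`, `Z′(ρ₀,s σ³)` (`Z = hsCompressibility`) are
jointly continuous in `(s, x)` on the slab, for a numeric guard `η₁ = min (1/(32 e v₁)) (η_E/8)` (`η_E`
the EOS chart of `hsEosLowDensity_proof`).

Outline: the guard gives `M_s σ³ ≤ η₁` (`M_s = sup β_s`), hence the smallness package
`SmallDensity (profileOf a_s) σ` with `θ_s ≤ 1/16` (`UniformLGC.smallDensity_of_eta_le`); `β` is jointly
continuous (`∫ a_s` is continuous in `s`, parametric integral over the compact torus), hence uniformly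
continuous on the compact slab, so `s ↦ R_s` is continuous on `[0,t₁]` by the profile-Lipschitz bound
`UniformLGC.abs_ratioLimit_sub_le`; the cluster series has the uniform geometric majorant
`2e (η₁/σ³) 16^{-j}` (`SmallDensity.abs_rhoLim_term_le`), so `ρ₀` is jointly continuous
(`continuousOn_tsum`). Finally `0 < ρ₀,s(x) σ³ ≤ 6 M_s σ³ ≤ 6η₁ < η_E`
(`UniformLGC.rhoLim_pos_of_geomRatio_le`, `|ρ₀| ≤ 2eM/(1−θ)`), and `Z`, `Z′` are smooth on `(0, η_E)`
(`ClampedCurrentsDockFreezeToolkit.contDiffOn_hsCompressibility`), so the compositions are continuous.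

References: Olla–Varadhan–Yau, Comm. Math. Phys. 155 (1993) 523, §2–3; Spohn, *Large Scale Dynamics of
Interacting Particles* (1991), Part I §2.3; Ruelle, *Statistical Mechanics* (1969), §3.4, §4.2.
-/

noncomputable section

open MeasureTheory Set Filter
open scoped ENNReal Topology BigOperators

namespace Summit.AtomisticToContinuum.HydrodynamicLimit.Theorems.LocalClampedTransferSketch

open Literature.Analysis.FluidPDE (HardSphereFlow Config localMaxwellian canonicalDensity liouville
  hardSphereDomain configEnergy)
open Literature.MathematicalPhysics.KineticTheory (T3 V3 hsDiameter localGibbsLaw localGibbsMeasure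
  localGibbsProfile rhoLim profileOf hsCompressibility)
open Literature.Analysis.FluidPDE Literature.MathematicalPhysics.KineticTheory
  Literature.Analysis.FunctionSpaces

/-! ### Profile-wise smallness from the packing guard -/

/-- The packing guard `σ³ · sup b ≤ η₁ ∫ b` bounds the sup of the normalised profile:
`(profileOf b).M · σ³ ≤ η₁`. -/
theorem efm_M_mul_le {b : T3 → ℝ} (hb : Continuous b) (hb0 : ∀ x, 0 < b x) {σ η₁ : ℝ} (hσ : 0 ≤ σ)
    (hg : σ ^ 3 * (⨆ x, b x) ≤ η₁ * ∫ x, b x) : (profileOf b hb hb0).M * σ ^ 3 ≤ η₁ := by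
  have hI : 0 < ∫ y, b y := integral_pos_of_continuous_pos hb hb0
  have hbdd : BddAbove (Set.range b) := (isCompact_range hb).bddAbove
  have hM : (profileOf b hb hb0).M ≤ (⨆ x, b x) / ∫ y, b y := by
    refine csSup_le (Set.range_nonempty _) ?_
    rintro _ ⟨y, rfl⟩
    rw [profileOf_β]
    exact div_le_div_of_nonneg_right (le_ciSup hbdd y) hI.le
  have hσ3 : 0 ≤ σ ^ 3 := pow_nonneg hσ 3
  calc (profileOf b hb hb0).M * σ ^ 3 ≤ (⨆ x, b x) / (∫ y, b y) * σ ^ 3 :=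
        mul_le_mul_of_nonneg_right hM hσ3
    _ = σ ^ 3 * (⨆ x, b x) / ∫ y, b y := by ring
    _ ≤ η₁ * (∫ y, b y) / ∫ y, b y := div_le_div_of_nonneg_right hg hI.le
    _ = η₁ := by field_simp

/-- From `M σ³ ≤ η₁` and `e v₁ η₁ ≤ 1/32`: the smallness parameter `e M v₁ σ³ ≤ 1/32`. -/
theorem efm_eta_le {M σ η₁ : ℝ} (hM : M * σ ^ 3 ≤ η₁) (hη : Real.exp 1 * v₁ * η₁ ≤ 1 / 32) :
    Real.exp 1 * (M * v₁ * σ ^ 3) ≤ 1 / 32 := by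
  have hv := v₁_pos.le
  have he := (Real.exp_pos 1).le
  calc Real.exp 1 * (M * v₁ * σ ^ 3) = Real.exp 1 * v₁ * (M * σ ^ 3) := by ring
    _ ≤ Real.exp 1 * v₁ * η₁ := mul_le_mul_of_nonneg_left hM (mul_nonneg he hv)
    _ ≤ 1 / 32 := hη

/-- The smallness package of a profile with `M σ³ ≤ η₁`, `e v₁ η₁ ≤ 1/32`, `0 < σ < 1/2`. -/
theorem efm_smallDensity {P : DensityProfile} {σ η₁ : ℝ} (hσ : 0 < σ) (hσ2 : σ < 1 / 2)
    (hM : P.M * σ ^ 3 ≤ η₁) (hη : Real.exp 1 * v₁ * η₁ ≤ 1 / 32) : SmallDensity P σ :=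
  UniformLGC.smallDensity_of_eta_le hσ hσ2 le_rfl (efm_eta_le hM hη)

/-- The geometric ratio of a profile with `M σ³ ≤ η₁`, `e v₁ η₁ ≤ 1/32` is at most `1/16`. -/
theorem efm_geomRatio_le {P : DensityProfile} {σ η₁ : ℝ} (hσ : 0 ≤ σ) (hM : P.M * σ ^ 3 ≤ η₁)
    (hη : Real.exp 1 * v₁ * η₁ ≤ 1 / 32) : geomRatio P σ ≤ 1 / 16 := by
  have h := UniformLGC.geomRatio_le_of_M_le (P := P) hσ le_rfl
  have := efm_eta_le hM hη
  linarith

/-- **Size of the limit density**: `|ρ₀(x)| ≤ 2eM/(1−θ) ≤ 6M` when `θ ≤ 1/16`. -/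
theorem efm_abs_rhoLim_le {P : DensityProfile} {σ : ℝ} (h : SmallDensity P σ)
    (hθ : geomRatio P σ ≤ 1 / 16) (x : T3) : |rhoLim P σ x| ≤ 6 * P.M := by
  have hθ0 := h.geomRatio_nonneg
  have hM := P.M_pos
  have he1 : Real.exp 1 < 2.7182818286 := Real.exp_one_lt_d9
  have he0 := (Real.exp_pos 1).le
  have hgeo : HasSum (fun j : ℕ => 2 * Real.exp 1 * P.M * geomRatio P σ ^ j)
      (2 * Real.exp 1 * P.M * (1 - geomRatio P σ)⁻¹) :=
    (hasSum_geometric_of_lt_one hθ0 h.geomRatio_lt_one).mul_left _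
  have h1 : ‖∑' j, clusterCoeff σ j * ratioLimit P σ ^ (j + 1) * P.β x ^ (j + 1)‖ ≤
      2 * Real.exp 1 * P.M * (1 - geomRatio P σ)⁻¹ :=
    tsum_of_norm_bounded hgeo fun j => (Real.norm_eq_abs _).trans_le (h.abs_rhoLim_term_le j x)
  rw [Real.norm_eq_abs] at h1
  have hinv : (1 - geomRatio P σ)⁻¹ ≤ 16 / 15 := by
    rw [inv_le_comm₀ (by linarith) (by norm_num)]; linarith
  have hinv0 : 0 ≤ (1 - geomRatio P σ)⁻¹ := inv_nonneg.2 (by linarith)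
  calc |rhoLim P σ x| ≤ 2 * Real.exp 1 * P.M * (1 - geomRatio P σ)⁻¹ := h1
    _ ≤ 2 * 2.7182818286 * P.M * (16 / 15) := by gcongr
    _ ≤ 6 * P.M := by nlinarith

/-- **The packing stays in the EOS chart**: under the guard, `0 < ρ₀(x) σ³ < η_E` once `6η₁ < η_E`. -/
theorem efm_rhoLim_mul_mem {b : T3 → ℝ} (hb : Continuous b) (hb0 : ∀ x, 0 < b x) {σ η₁ ηE : ℝ}
    (hσ : 0 < σ) (hσ2 : σ < 1 / 2) (hη : Real.exp 1 * v₁ * η₁ ≤ 1 / 32) (hηE : 6 * η₁ < ηE)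
    (hg : σ ^ 3 * (⨆ x, b x) ≤ η₁ * ∫ x, b x) (x : T3) :
    rhoLim (profileOf b hb hb0) σ x * σ ^ 3 ∈ Ioo 0 ηE := by
  have hM := efm_M_mul_le hb hb0 hσ.le hg
  have hsd := efm_smallDensity (P := profileOf b hb hb0) hσ hσ2 hM hη
  have hθ := efm_geomRatio_le (P := profileOf b hb hb0) hσ.le hM hη
  have hσ3 : 0 < σ ^ 3 := pow_pos hσ 3
  refine ⟨mul_pos (UniformLGC.rhoLim_pos_of_geomRatio_le hsd hθ x) hσ3, ?_⟩
  have h1 := (le_abs_self _).trans (efm_abs_rhoLim_le hsd hθ x)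
  calc rhoLim (profileOf b hb hb0) σ x * σ ^ 3 ≤ 6 * (profileOf b hb hb0).M * σ ^ 3 :=
        mul_le_mul_of_nonneg_right h1 hσ3.le
    _ = 6 * ((profileOf b hb hb0).M * σ ^ 3) := by ring
    _ ≤ 6 * η₁ := by gcongr
    _ < ηE := hηE

/-! ### Joint continuity of the normalised profile and of the limit insertion ratio -/

/-- **Transverse modulus of a jointly continuous family** on the compact slab `[0,t₁] × 𝕋³`:
`|F s x − F s' x| ≤ e` for `s, s' ∈ [0,t₁]` with `dist s s' < δ(e)`, uniformly in `x`. -/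
theorem efm_family_modulus (t₁ : ℝ) {F : ℝ → T3 → ℝ} (hF : Continuous fun q : ℝ × T3 => F q.1 q.2)
    {e : ℝ} (he : 0 < e) :
    ∃ δ : ℝ, 0 < δ ∧ ∀ s ∈ Icc 0 t₁, ∀ s' ∈ Icc 0 t₁, dist s s' < δ → ∀ x : T3, |F s x - F s' x| ≤ e := by
  have hK : IsCompact (Icc (0 : ℝ) t₁ ×ˢ (univ : Set T3)) := isCompact_Icc.prod isCompact_univ
  have hUC := hK.uniformContinuousOn_of_continuous hF.continuousOn
  rw [Metric.uniformContinuousOn_iff_le] at hUC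
  obtain ⟨δ, hδ, h⟩ := hUC e he
  refine ⟨δ, hδ, fun s hs s' hs' hss' x => ?_⟩
  have hd : dist (s, x) (s', x) ≤ δ := by
    rw [Prod.dist_eq, dist_self, max_eq_left dist_nonneg]; exact hss'.le
  have := h (s, x) (mk_mem_prod hs (mem_univ x)) (s', x) (mk_mem_prod hs' (mem_univ x)) hd
  rwa [Real.dist_eq] at this

/-- The normalised profile `(s, x) ↦ β_s(x) = a s x / ∫ a s` of a jointly continuous positive family is
jointly continuous (the mass `∫ a s` is continuous in `s`: parametric integral over the compact torus). -/
theorem efm_continuous_beta {a : ℝ → T3 → ℝ} (ha : ∀ s, Continuous (a s))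
    (hau : Continuous (Function.uncurry a)) (ha0 : ∀ s x, 0 < a s x) :
    Continuous fun q : ℝ × T3 => (profileOf (a q.1) (ha q.1) (ha0 q.1)).β q.2 := by
  have hI : Continuous fun s : ℝ => ∫ y, a s y := by
    simpa only [Measure.restrict_univ] using
      continuous_parametric_integral_of_continuous hau isCompact_univ
  have hau' : Continuous fun q : ℝ × T3 => a q.1 q.2 := hau
  simp only [profileOf_β]
  exact hau'.div (hI.comp continuous_fst) fun q => (integral_pos_of_continuous_pos (ha q.1) (ha0 q.1)).ne'

/-- **The limit insertion ratio is continuous along the family**: under the packing guard on `[0,t₁]`,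
`s ↦ R_s = ratioLimit (profileOf a_s) σ` is continuous on `[0,t₁]` (profile-Lipschitz bound
`UniformLGC.abs_ratioLimit_sub_le` + the transverse modulus of `β`). -/
theorem efm_continuousOn_ratio {a : ℝ → T3 → ℝ} (ha : ∀ s, Continuous (a s))
    (hau : Continuous (Function.uncurry a)) (ha0 : ∀ s x, 0 < a s x) {σ η₁ t₁ : ℝ} (hσ : 0 < σ)
    (hσ2 : σ < 1 / 2) (hη : Real.exp 1 * v₁ * η₁ ≤ 1 / 32)
    (hg : ∀ s ∈ Icc 0 t₁, σ ^ 3 * (⨆ x, a s x) ≤ η₁ * ∫ x, a s x) :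
    ContinuousOn (fun s => ratioLimit (profileOf (a s) (ha s) (ha0 s)) σ) (Icc 0 t₁) := by
  rw [Metric.continuousOn_iff]
  intro s₀ hs₀ ε hε
  obtain ⟨δ, hδ, hmod⟩ := efm_family_modulus t₁ (F := fun s y => (profileOf (a s) (ha s) (ha0 s)).β y)
    (efm_continuous_beta ha hau ha0) (by positivity : (0 : ℝ) < ε / 13)
  refine ⟨δ, hδ, fun s hs hd => ?_⟩
  have hv := v₁_pos
  have he0 := Real.exp_pos 1
  have he1 : Real.exp 1 < 2.7182818286 := Real.exp_one_lt_d9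
  have hσ3 : 0 < σ ^ 3 := pow_pos hσ 3
  set P := profileOf (a s₀) (ha s₀) (ha0 s₀) with hP
  set Q := profileOf (a s) (ha s) (ha0 s) with hQ
  have hMP : P.M * σ ^ 3 ≤ η₁ := efm_M_mul_le (ha s₀) (ha0 s₀) hσ.le (hg s₀ hs₀)
  have hMQ : Q.M * σ ^ 3 ≤ η₁ := efm_M_mul_le (ha s) (ha0 s) hσ.le (hg s hs)
  have hM0 : 0 < max P.M Q.M := P.M_pos.trans_le (le_max_left _ _)
  have hMs : max P.M Q.M * σ ^ 3 ≤ η₁ := by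
    rw [max_mul_of_nonneg _ _ hσ3.le]; exact max_le hMP hMQ
  have hηs : Real.exp 1 * (max P.M Q.M * v₁ * σ ^ 3) ≤ 1 / 32 := efm_eta_le hMs hη
  have hηs0 : 0 ≤ Real.exp 1 * (max P.M Q.M * v₁ * σ ^ 3) := by positivity
  have hω : ∀ y, |Q.β y - P.β y| ≤ ε / 13 := fun y => hmod s hs s₀ hs₀ hd y
  have hdiff := UniformLGC.abs_ratioLimit_sub_le (efm_smallDensity hσ hσ2 hMP hη)
    (efm_smallDensity hσ hσ2 hMQ hη) (le_max_left _ _) (le_max_right _ _) hηs hω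
  rw [Real.dist_eq]
  have hden : (15 / 16 : ℝ) ^ 2 ≤ (1 - 2 * (Real.exp 1 * (max P.M Q.M * v₁ * σ ^ 3))) ^ 2 :=
    pow_le_pow_left₀ (by norm_num) (by linarith) 2
  have h1 : Real.exp 1 * (ε / 13) / (1 - 2 * (Real.exp 1 * (max P.M Q.M * v₁ * σ ^ 3))) ^ 2 ≤
      Real.exp 1 * (ε / 13) / (15 / 16 : ℝ) ^ 2 :=
    div_le_div_of_nonneg_left (by positivity) (by norm_num) hden
  have h2 : Real.exp 1 * ε < 2.7182818286 * ε := mul_lt_mul_of_pos_right he1 hε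
  calc |ratioLimit Q σ - ratioLimit P σ|
      ≤ 4 * (Real.exp 1 * (ε / 13) / (1 - 2 * (Real.exp 1 * (max P.M Q.M * v₁ * σ ^ 3))) ^ 2) := hdiff
    _ ≤ 4 * (Real.exp 1 * (ε / 13) / (15 / 16 : ℝ) ^ 2) := by linarith
    _ = 1024 / 2925 * (Real.exp 1 * ε) := by ring
    _ < ε := by linarith

/-! ### Joint continuity of the limit density -/

/-- **The limit density is jointly continuous along the family** on `[0,t₁] × 𝕋³` (termwise continuity +
the uniform geometric majorant `2e (η₁/σ³) 16^{-j}` of the cluster series, `continuousOn_tsum`). -/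
theorem efm_continuousOn_rhoLim {a : ℝ → T3 → ℝ} (ha : ∀ s, Continuous (a s))
    (hau : Continuous (Function.uncurry a)) (ha0 : ∀ s x, 0 < a s x) {σ η₁ t₁ : ℝ} (hσ : 0 < σ)
    (hσ2 : σ < 1 / 2) (hη : Real.exp 1 * v₁ * η₁ ≤ 1 / 32)
    (hg : ∀ s ∈ Icc 0 t₁, σ ^ 3 * (⨆ x, a s x) ≤ η₁ * ∫ x, a s x) :
    ContinuousOn (fun p : ℝ × T3 => rhoLim (profileOf (a p.1) (ha p.1) (ha0 p.1)) σ p.2)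
      (Icc 0 t₁ ×ˢ univ) := by
  have hR : ContinuousOn (fun p : ℝ × T3 => ratioLimit (profileOf (a p.1) (ha p.1) (ha0 p.1)) σ)
      (Icc 0 t₁ ×ˢ univ) :=
    (efm_continuousOn_ratio ha hau ha0 hσ hσ2 hη hg).comp' continuousOn_fst fun p hp => (mem_prod.1 hp).1
  have hβ := efm_continuous_beta ha hau ha0
  have hσ3 : 0 < σ ^ 3 := pow_pos hσ 3
  have he0 := (Real.exp_pos 1).le
  show ContinuousOn (fun p : ℝ × T3 => ∑' j : ℕ, clusterCoeff σ j *
      ratioLimit (profileOf (a p.1) (ha p.1) (ha0 p.1)) σ ^ (j + 1) *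
        (profileOf (a p.1) (ha p.1) (ha0 p.1)).β p.2 ^ (j + 1)) (Icc 0 t₁ ×ˢ univ)
  refine continuousOn_tsum (u := fun j : ℕ => 2 * Real.exp 1 * (η₁ / σ ^ 3) * (1 / 16 : ℝ) ^ j)
    (fun j => (continuousOn_const.mul (hR.pow _)).mul (hβ.continuousOn.pow _))
    ((summable_geometric_of_lt_one (by norm_num) (by norm_num)).mul_left _) ?_
  rintro j ⟨s, x⟩ hp
  have hs : s ∈ Icc 0 t₁ := (mem_prod.1 hp).1
  have hM := efm_M_mul_le (ha s) (ha0 s) hσ.le (hg s hs)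
  have hsd := efm_smallDensity (P := profileOf (a s) (ha s) (ha0 s)) hσ hσ2 hM hη
  have hθ := efm_geomRatio_le (P := profileOf (a s) (ha s) (ha0 s)) hσ.le hM hη
  have hθ0 := hsd.geomRatio_nonneg
  have hM' : (profileOf (a s) (ha s) (ha0 s)).M ≤ η₁ / σ ^ 3 := by rwa [le_div_iff₀ hσ3]
  have hη0 : 0 ≤ η₁ := (mul_pos (profileOf (a s) (ha s) (ha0 s)).M_pos hσ3).le.trans hM
  have hc0 : 0 ≤ 2 * Real.exp 1 * (η₁ / σ ^ 3) := by positivity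
  refine (Real.norm_eq_abs _).trans_le ((hsd.abs_rhoLim_term_le j x).trans ?_)
  gcongr

/-! ### The stub -/

/-- **S2 — EOS fields along a profile family are jointly continuous** (stub `stub_eosFieldFamilyModulus`
of line `Sketch`, crux `LocalClampedTransferLDAlongFamilies`, stmt-AtomisticToContinuum-17691): there is a
packing guard `η₁ > 0` such that along every jointly continuous positive activity family `a` on
`[0,t₁] × 𝕋³` with `σ³ sup a_s ≤ η₁ ∫ a_s` (`0 < σ < 1/2`) the limit density
`ρ₀,s = rhoLim (profileOf a_s) σ` and the EOS coefficients `Z(ρ₀,s σ³)`, `Z′(ρ₀,s σ³)` are jointly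
continuous on the slab. -/
theorem stub_eosFieldFamilyModulus :
    ∃ η₁ : ℝ, 0 < η₁ ∧ ∀ (t₁ : ℝ) (a : ℝ → T3 → ℝ) (ha : ∀ s, Continuous (a s)),
      Continuous (Function.uncurry a) → ∀ (ha0 : ∀ s x, 0 < a s x),
      ∀ σ : ℝ, 0 < σ → σ < 1 / 2 → (∀ s ∈ Set.Icc 0 t₁, σ ^ 3 * (⨆ x, a s x) ≤ η₁ * ∫ x, a s x) →
      ContinuousOn (fun p : ℝ × T3 => rhoLim (profileOf (a p.1) (ha p.1) (ha0 p.1)) σ p.2)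
          (Set.Icc 0 t₁ ×ˢ Set.univ) ∧
        ContinuousOn (fun p : ℝ × T3 =>
            hsCompressibility (rhoLim (profileOf (a p.1) (ha p.1) (ha0 p.1)) σ p.2 * σ ^ 3))
          (Set.Icc 0 t₁ ×ˢ Set.univ) ∧
        ContinuousOn (fun p : ℝ × T3 =>
            deriv hsCompressibility (rhoLim (profileOf (a p.1) (ha p.1) (ha0 p.1)) σ p.2 * σ ^ 3))
          (Set.Icc 0 t₁ ×ˢ Set.univ) := by
  obtain ⟨ηE, hηE, F, hF, hEq, -, -, -⟩ := hsEosLowDensity_proof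
  -- the EOS window: `Z = 1 + η F′(η)` on `(0, η_E)`, so `Z`, `Z′` are smooth there
  have hZ : ∀ η ∈ Ioo 0 ηE, hsCompressibility η = 1 + η * deriv F η := fun η hη => by
    have hnhds : hsExcessFreeEnergy =ᶠ[𝓝 η] F :=
      hEq.eventuallyEq_of_mem (mem_of_superset (Ioo_mem_nhds hη.1 hη.2) Ioo_subset_Ico_self)
    show 1 + η * deriv hsExcessFreeEnergy η = 1 + η * deriv F η
    rw [hnhds.deriv_eq]
  obtain ⟨hZc, hZ'c⟩ := ClampedCurrentsDockFreezeToolkit.contDiffOn_hsCompressibility hF hZ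
  have hv := v₁_pos
  have he0 := Real.exp_pos 1
  refine ⟨min (1 / (32 * Real.exp 1 * v₁)) (ηE / 8), lt_min (by positivity) (by positivity), ?_⟩
  intro t₁ a ha hau ha0 σ hσ hσ2 hg
  have hη : Real.exp 1 * v₁ * min (1 / (32 * Real.exp 1 * v₁)) (ηE / 8) ≤ 1 / 32 :=
    calc Real.exp 1 * v₁ * min (1 / (32 * Real.exp 1 * v₁)) (ηE / 8)
        ≤ Real.exp 1 * v₁ * (1 / (32 * Real.exp 1 * v₁)) :=
          mul_le_mul_of_nonneg_left (min_le_left _ _) (by positivity)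
      _ = 1 / 32 := by field_simp
  have hηE' : 6 * min (1 / (32 * Real.exp 1 * v₁)) (ηE / 8) < ηE := by
    have := min_le_right (1 / (32 * Real.exp 1 * v₁)) (ηE / 8); linarith
  have hρ := efm_continuousOn_rhoLim ha hau ha0 hσ hσ2 hη hg
  have hρσ : ContinuousOn (fun p : ℝ × T3 =>
      rhoLim (profileOf (a p.1) (ha p.1) (ha0 p.1)) σ p.2 * σ ^ 3) (Icc 0 t₁ ×ˢ univ) :=
    hρ.mul continuousOn_const
  have hmaps : MapsTo (fun p : ℝ × T3 => rhoLim (profileOf (a p.1) (ha p.1) (ha0 p.1)) σ p.2 * σ ^ 3)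
      (Icc 0 t₁ ×ˢ univ) (Ioo 0 ηE) := by
    rintro ⟨s, x⟩ hp
    exact efm_rhoLim_mul_mem (ha s) (ha0 s) hσ hσ2 hη hηE' (hg s (mem_prod.1 hp).1) x
  exact ⟨hρ, hZc.continuousOn.comp' hρσ hmaps, hZ'c.continuousOn.comp' hρσ hmaps⟩

end Summit.AtomisticToContinuum.HydrodynamicLimit.Theorems.LocalClampedTransferSketch

end
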